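/-
Copyright: the b2b-balaban T⁴-continuum CRUX team, row NE7b OWNER lineage `t4-ne7b-p1` (gen 106). Project licence.
-/
import Literature.Analysis.FunctionSpaces.BochnerProofs
import Mathlib.Analysis.SpecialFunctions.Gaussian.FourierTransform
import Mathlib.Analysis.Calculus.Gradient.Basic

/-!
# THE WINDOW-MASS LETTER OF THE CONVEXITY ROAD, SUPPLIED: for a `λ`-convex, `Λ`-smooth exponent a Euclidean ball of radius `R` about the
# minimiser carries all but the fraction `η = e^{−λR²∕4}·(4π∕λ)^{d∕2}∕(2π∕Λ)^{d∕2}` of the tilted mass — two-sided Gaussian domination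
# (row NE7b, node U5c; the `hmass` letter of `…ConvexTiltMoment.exp_moment_le_of_uniformlyConvex_window`; kernel lemmas of real analysis)

Cell `pub-balaban`, sub-cell `t4`, spine estimate NE7b (`T4WeightBudget.RelWeightBound`; the cell's OWN estimate — NOT PRINTED in
[Bałaban 1983–89], NOT PROVED).  Crux-route work under `Spine/NE7b/` by the row's OWNER; NOTHING of Bałaban's is named or asserted;
no `T4Continuum/Support` leaf typed; no `def`; zero `sorry`.

WHY.  `…ConvexTiltMoment` §4 (the convexity road ON A WINDOW) displays `hmass : (1−η)·∫e^{−V} ≤ ∫_K e^{−V}` — the window carries the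
fraction `1−η` of the tilted mass (the refuter's «window-mass letter for the log-concave tilted measure, (R1″)-class: Gaussian
concentration under uniform convexity, affordable», PRICING-NE7b v72 F395 (Q1)(a)).  THIS FILE supplies it in the model class where the
exponent is pinched between two paraboloids at its minimiser `x₀`: `V x₀ + (λ∕2)‖y−x₀‖² ≤ V y ≤ V x₀ + (Λ∕2)‖y−x₀‖²` (the lower pinch is
first-order `λ`-convexity at a critical point; the upper one is `Λ`-smoothness).  Then `∫e^{−V} ≥ e^{−V x₀}(2π∕Λ)^{d∕2}`, the mass
outside the ball `‖y−x₀‖ < R` is `≤ e^{−V x₀}e^{−λR²∕4}(4π∕λ)^{d∕2}`, hence the ball carries all but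
`η = e^{−λR²∕4}·(4π∕λ)^{d∕2}∕(2π∕Λ)^{d∕2}` (`d` = dimension — REGION-extensive, as every letter of the road; print's per-bond windows
CONTAIN such a ball of the per-bond radius).

WHAT IS PROVED ([folklore]; `GaussianFourier.integral_rexp_neg_mul_sq_norm`, `Literature.Analysis.FunctionSpaces.integrable_rexp_neg_mul_sq_norm`,
translation invariance of Lebesgue measure): `lowerPinch_of_firstOrder` (the lower pinch from the first-order letter at a critical point),
**`integral_exp_neg_ge_of_upperPinch`**, **`tailIntegral_exp_neg_le_of_lowerPinch`**, **`ballMass_ge_of_pinch`** (the `hmass` letter with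
`K = ball x₀ R`).

NOT HERE (honest): the pinch constants for Bałaban's exponents ((A1c) readings); anything of Bałaban's.  NE7b NOT PRINTED ∕ NOT PROVED;
spine PROVED 0∕9; rung (B)+1 on a FINITE torus — NOT infinite volume, NOT the mass gap, NOT Clay.
HONEST DEPENDENCY: continuum YM on T⁴ ⇐ BetaPertH ∧ nine spine estimates (0/9 proved); BetaPertH ⇐ (D1) ∧ (D4) ∧ CAP+tail.
-/

set_option autoImplicit false

noncomputable section

open MeasureTheory Real
open scoped RealInnerProductSpace

namespace Summit.QuantumFields.BalabanUV.T4Continuum.NE7b.ConvexWindowMass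

variable {n : ℕ}

/-- The LOWER PINCH from the first-order convexity letter at a critical point: `∇V x₀ = 0` and
`V x + ⟪∇V x, y−x⟫ + (λ∕2)‖y−x‖² ≤ V y` give `V x₀ + (λ∕2)‖y−x₀‖² ≤ V y`. [folklore] -/
theorem lowerPinch_of_firstOrder {V : EuclideanSpace ℝ (Fin n) → ℝ} {lam : ℝ} {x₀ : EuclideanSpace ℝ (Fin n)}
    (hV : ∀ x y : EuclideanSpace ℝ (Fin n), V x + ⟪gradient V x, y - x⟫ + lam / 2 * ‖y - x‖ ^ 2 ≤ V y)
    (hcrit : gradient V x₀ = 0) (y : EuclideanSpace ℝ (Fin n)) : V x₀ + lam / 2 * ‖y - x₀‖ ^ 2 ≤ V y := by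
  have := hV x₀ y
  rwa [hcrit, inner_zero_left, add_zero] at this

/-- **LOWER BOUND OF THE MASS FROM THE UPPER PINCH**: `V y ≤ V x₀ + (Λ∕2)‖y−x₀‖²` (`Λ > 0`) and `e^{−V}` integrable give
`e^{−V x₀}·(π∕(Λ∕2))^{d∕2} ≤ ∫e^{−V}`, `d = finrank`. [folklore] -/
theorem integral_exp_neg_ge_of_upperPinch {V : EuclideanSpace ℝ (Fin n) → ℝ} {Lam : ℝ} (hLam : 0 < Lam)
    (x₀ : EuclideanSpace ℝ (Fin n)) (hup : ∀ y, V y ≤ V x₀ + Lam / 2 * ‖y - x₀‖ ^ 2)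
    (hZ : Integrable fun y => exp (-V y)) :
    exp (-V x₀) * (π / (Lam / 2)) ^ (Module.finrank ℝ (EuclideanSpace ℝ (Fin n)) / 2 : ℝ) ≤ ∫ y, exp (-V y) := by
  have hb : 0 < Lam / 2 := by positivity
  rw [← GaussianFourier.integral_rexp_neg_mul_sq_norm hb, ← integral_const_mul,
    ← integral_sub_right_eq_self (fun v : EuclideanSpace ℝ (Fin n) => exp (-V x₀) * exp (-(Lam / 2) * ‖v‖ ^ 2)) x₀]
  refine integral_mono_of_nonneg (ae_of_all _ fun y => mul_nonneg (exp_pos _).le (exp_pos _).le) hZ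
    (ae_of_all _ fun y => ?_)
  show exp (-V x₀) * exp (-(Lam / 2) * ‖y - x₀‖ ^ 2) ≤ exp (-V y)
  rw [← exp_add]
  exact exp_le_exp.2 (by nlinarith [hup y])

/-- **THE TAIL OUTSIDE A BALL FROM THE LOWER PINCH**: `V x₀ + (λ∕2)‖y−x₀‖² ≤ V y` (`λ > 0`), `0 ≤ R`:
`∫_{R ≤ ‖y−x₀‖} e^{−V} ≤ e^{−V x₀}·e^{−λR²∕4}·(π∕(λ∕4))^{d∕2}`. [folklore] -/
theorem tailIntegral_exp_neg_le_of_lowerPinch {V : EuclideanSpace ℝ (Fin n) → ℝ} {lam R : ℝ} (hlam : 0 < lam) (hR : 0 ≤ R)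
    (x₀ : EuclideanSpace ℝ (Fin n)) (hlow : ∀ y, V x₀ + lam / 2 * ‖y - x₀‖ ^ 2 ≤ V y)
    (hZ : Integrable fun y => exp (-V y)) :
    ∫ y in {y | R ≤ ‖y - x₀‖}, exp (-V y) ≤
      exp (-V x₀) * exp (-(lam * R ^ 2 / 4)) * (π / (lam / 4)) ^ (Module.finrank ℝ (EuclideanSpace ℝ (Fin n)) / 2 : ℝ) := by
  have hb : 0 < lam / 4 := by positivity
  have hS : MeasurableSet {y : EuclideanSpace ℝ (Fin n) | R ≤ ‖y - x₀‖} :=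
    measurableSet_le measurable_const (continuous_id.sub continuous_const).norm.measurable
  -- the Gaussian majorant, integrable by translation
  have hGi : Integrable fun y : EuclideanSpace ℝ (Fin n) =>
      (exp (-V x₀) * exp (-(lam * R ^ 2 / 4))) * exp (-(lam / 4) * ‖y - x₀‖ ^ 2) :=
    ((Literature.Analysis.FunctionSpaces.integrable_rexp_neg_mul_sq_norm hb).comp_sub_right x₀).const_mul _
  calc ∫ y in {y | R ≤ ‖y - x₀‖}, exp (-V y)
      ≤ ∫ y in {y | R ≤ ‖y - x₀‖}, (exp (-V x₀) * exp (-(lam * R ^ 2 / 4))) * exp (-(lam / 4) * ‖y - x₀‖ ^ 2) := by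
        refine setIntegral_mono_on hZ.integrableOn hGi.integrableOn hS fun y hy => ?_
        rw [← exp_add, ← exp_add]
        refine exp_le_exp.2 ?_
        have hy' : R ≤ ‖y - x₀‖ := hy
        have hsq : R ^ 2 ≤ ‖y - x₀‖ ^ 2 := pow_le_pow_left₀ hR hy' 2
        nlinarith [hlow y]
    _ ≤ ∫ y, (exp (-V x₀) * exp (-(lam * R ^ 2 / 4))) * exp (-(lam / 4) * ‖y - x₀‖ ^ 2) :=
        setIntegral_le_integral hGi (ae_of_all _ fun y => mul_nonneg (mul_nonneg (exp_pos _).le (exp_pos _).le) (exp_pos _).le)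
    _ = exp (-V x₀) * exp (-(lam * R ^ 2 / 4)) * (π / (lam / 4)) ^ (Module.finrank ℝ (EuclideanSpace ℝ (Fin n)) / 2 : ℝ) := by
        rw [integral_const_mul, integral_sub_right_eq_self (fun v : EuclideanSpace ℝ (Fin n) => exp (-(lam / 4) * ‖v‖ ^ 2)) x₀,
          GaussianFourier.integral_rexp_neg_mul_sq_norm hb]

/-- **THE BALL CARRIES ALL BUT THE FRACTION `η`** (the `hmass` letter of `…ConvexTiltMoment.exp_moment_le_of_uniformlyConvex_window` with
`K = ball x₀ R`): under both pinches,
`(1 − η)·∫e^{−V} ≤ ∫_{‖y−x₀‖<R} e^{−V}` with `η = e^{−λR²∕4}·(π∕(λ∕4))^{d∕2}∕(π∕(Λ∕2))^{d∕2}`. [folklore] -/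
theorem ballMass_ge_of_pinch {V : EuclideanSpace ℝ (Fin n) → ℝ} {lam Lam R : ℝ} (hlam : 0 < lam) (hLam : 0 < Lam) (hR : 0 ≤ R)
    (x₀ : EuclideanSpace ℝ (Fin n)) (hlow : ∀ y, V x₀ + lam / 2 * ‖y - x₀‖ ^ 2 ≤ V y)
    (hup : ∀ y, V y ≤ V x₀ + Lam / 2 * ‖y - x₀‖ ^ 2) (hZ : Integrable fun y => exp (-V y)) :
    (1 - exp (-(lam * R ^ 2 / 4)) * (π / (lam / 4)) ^ (Module.finrank ℝ (EuclideanSpace ℝ (Fin n)) / 2 : ℝ) /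
        (π / (Lam / 2)) ^ (Module.finrank ℝ (EuclideanSpace ℝ (Fin n)) / 2 : ℝ)) * ∫ y, exp (-V y) ≤
      ∫ y in {y | ‖y - x₀‖ < R}, exp (-V y) := by
  set d2 : ℝ := (Module.finrank ℝ (EuclideanSpace ℝ (Fin n)) / 2 : ℝ) with hd2
  have hS : MeasurableSet {y : EuclideanSpace ℝ (Fin n) | ‖y - x₀‖ < R} :=
    measurableSet_lt (continuous_id.sub continuous_const).norm.measurable measurable_const
  have hcompl : {y : EuclideanSpace ℝ (Fin n) | ‖y - x₀‖ < R}ᶜ = {y | R ≤ ‖y - x₀‖} := by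
    ext y; simp [not_lt]
  have hsplit := integral_add_compl hS hZ
  rw [hcompl] at hsplit
  -- the two Gaussian bounds
  have hlowZ := integral_exp_neg_ge_of_upperPinch hLam x₀ hup hZ
  have htail := tailIntegral_exp_neg_le_of_lowerPinch hlam hR x₀ hlow hZ
  have hG : 0 < (π / (Lam / 2)) ^ d2 := rpow_pos_of_pos (by positivity) _
  -- tail ≤ η·∫e^{−V}
  have htail' : ∫ y in {y | R ≤ ‖y - x₀‖}, exp (-V y) ≤
      (exp (-(lam * R ^ 2 / 4)) * (π / (lam / 4)) ^ d2 / (π / (Lam / 2)) ^ d2) * ∫ y, exp (-V y) := by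
    calc ∫ y in {y | R ≤ ‖y - x₀‖}, exp (-V y)
        ≤ exp (-V x₀) * exp (-(lam * R ^ 2 / 4)) * (π / (lam / 4)) ^ d2 := htail
      _ = (exp (-(lam * R ^ 2 / 4)) * (π / (lam / 4)) ^ d2 / (π / (Lam / 2)) ^ d2) *
            (exp (-V x₀) * (π / (Lam / 2)) ^ d2) := by
          field_simp
      _ ≤ (exp (-(lam * R ^ 2 / 4)) * (π / (lam / 4)) ^ d2 / (π / (Lam / 2)) ^ d2) * ∫ y, exp (-V y) :=
          mul_le_mul_of_nonneg_left hlowZ (by positivity)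
  have hball : ∫ y in {y | ‖y - x₀‖ < R}, exp (-V y) =
      (∫ y, exp (-V y)) - ∫ y in {y | R ≤ ‖y - x₀‖}, exp (-V y) := by linarith [hsplit]
  rw [hball]
  linarith [htail']

end Summit.QuantumFields.BalabanUV.T4Continuum.NE7b.ConvexWindowMass

end
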